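import Mathlib
import Literature.AlgebraicGeometry.Resolution.NormalizationOfVarietiesProofs
import Literature.AlgebraicGeometry.Resolution.SurfaceResolutionReduction
import Summits.ResolutionOfSingularities.ResolutionOfSingularities.Theorems.TeissierJungTeissierResolveRegularBranches
import Summits.ResolutionOfSingularities.ResolutionOfSingularities.Theorems.TeissierJungTeissierResolveBranchDictionaryLemmas
import HarnessLib

/-!
# `TeissierResolve`, line `Sketch` (toric normalisation + destackification): the branch dictionary

Route `ResolutionOfSingularities/TeissierJung`, crux `TeissierResolve`
(stmt-ResolutionOfSingularities-17086), stub `stub_branchDictionary` of the lead's skeleton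
(`Cruxes/TeissierResolve/Lines/Sketch.lean`, v3), PROVED here (statement verbatim from the
ledger registration). It is the first step of C⁺ (formal diagonalizable quotient singularities
of the normalisation): it identifies the completed local rings of `X'^ν` with the
normalisations of the analytic branches of `X'`, to which the Teissier presentation applies.

**Statement.** Let `X'` be an integral scheme, quasi-compact and locally of finite type over a
field `k`, `X'^ν → X'` its normalisation (`normalization`, `normalizationι`: Mathlib's relative
normalisation of `Spec K(X') → X'`) and `y ∈ X'^ν` a closed point over `x ∈ X'`. Then there
are a MINIMAL prime `P` of `𝒪̂_{X',x}` and a ring isomorphism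
`E : 𝒪̂_{X'^ν,y} ≃ integralClosure (𝒪̂_{X',x} ⧸ P) (Frac (𝒪̂_{X',x} ⧸ P))` with
`E(a) = a mod P` for `a ∈ 𝒪_{X',x}` ("the completed local rings of the normalisation are the
normalisations of the analytic branches": Zariski's analytic normality of normal varieties,
Nagata (37.5)–(37.8), Stacks 0C23 + 07N9).

**Proof.** Over an affine open `U = Spec A ∋ x`, `X'^ν ×_{X'} U = Spec C₀` with `C₀` the
integral closure of `A` in `K(X')` (`normalizationObjIso`): finite over `A` (E. Noether,
`NoetherFiniteIntegralClosure_holds`), birational, and with analytically irreducible, analytically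
normal local rings (Zariski, `isDomain_and_isIntegrallyClosed_adicCompletion_localization_atPrime`).
The stalks are `𝒪_{X',x} = A_𝔭` and `𝒪_{X'^ν,y} ≅ (C₀)_Q` for the maximal ideals `𝔭 ⊆ A`,
`Q ⊆ C₀` of the closed points `x`, `y` (`IsAffineOpen.isLocalization_stalk`; `Q` lies over `𝔭`),
compatibly with the stalk map (`Scheme.Hom.germ_stalkMap_apply`). Now apply the algebra of
`TeissierJungTeissierResolveBranchDictionaryLemmas.lean` (`exists_branchEquiv_of_isLocalization`):
with `C = C₀[(A ∖ 𝔭)⁻¹] ⊇ R = A_𝔭` and `𝔫 = QC`, `R̂ ⊗_R C ≅ Π (C_𝔪)^` (Stacks 07N9),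
`P = ker (R̂ → (C_𝔫)^)` is a minimal prime, and `R̂ ⧸ P ↪ (C_𝔫)^ ≅ 𝒪̂_{X'^ν,y}` is injective,
integral and birational into a normal domain, hence its normalisation.

Sources: O. Zariski, Ann. Inst. Fourier 2 (1950); Zariski–Samuel II, VIII §13; Nagata, *Local
Rings*, (37.5)–(37.8); Huneke–Swanson, *Integral Closure*, Ch. 9; Stacks 07N9, 0C23, 035E.
Everything here is [folklore]; no definitions, no named facts.
-/

noncomputable section

set_option linter.dupNamespace false -- mandated namespace of this single-conjunct summit

open CategoryTheory AlgebraicGeometry TopologicalSpace IsLocalRing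
open Literature.AlgebraicGeometry.Resolution
open Summit.ResolutionOfSingularities.ResolutionOfSingularities.Theorems.TeissierResolve.BranchDictionaryLemmas

namespace Summit.ResolutionOfSingularities.ResolutionOfSingularities.Theorems.TeissierResolve.BranchDictionary

/-- **The branch dictionary** (Zariski's analytic normality of normal varieties; Nagata
(37.5)–(37.8); Stacks 0C23 + 07N9). Let `X'` be an integral scheme, quasi-compact and locally
of finite type over a field `k`, and let `y` be a closed point of its normalisation `X'^ν`, over
`x ∈ X'`. Then the completed local ring `𝒪̂_{X'^ν,y}` is the NORMALISATION OF AN ANALYTIC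
BRANCH of `X'` at `x`: there are a minimal prime `P` of `𝒪̂_{X',x}` and a ring isomorphism
`𝒪̂_{X'^ν,y} ≅ integralClosure (𝒪̂_{X',x} ⧸ P) (Frac (𝒪̂_{X',x} ⧸ P))` compatible with
`𝒪_{X',x} → 𝒪_{X'^ν,y}`. Proof: over an affine open `U = Spec A ∋ x`, `X'^ν ×_{X'} U = Spec C₀`
with `C₀` the integral closure of `A` in `K(X')` — finite over `A` (E. Noether), birational,
with analytically irreducible and analytically normal local rings (Zariski,
`isDomain_and_isIntegrallyClosed_adicCompletion_localization_atPrime`); `𝒪_{X',x} = A_𝔭` and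
`𝒪_{X'^ν,y} = (C₀)_Q` for maximal ideals `Q` over `𝔭`; apply
`exists_branchEquiv_of_isLocalization`. [folklore] -/
theorem stub_branchDictionary {k : Type} [Field k] (X' : Scheme.{0}) [IsIntegral X']
    (f : X' ⟶ Spec (.of k)) [LocallyOfFiniteType f] [QuasiCompact f]
    (y : normalization X') (hy : IsClosed ({y} : Set (normalization X'))) :
    ∃ (P : Ideal (AdicCompletion (maximalIdeal (X'.presheaf.stalk ((normalizationι X').base y)))
          (X'.presheaf.stalk ((normalizationι X').base y))))
      (_ : P ∈ minimalPrimes (AdicCompletion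
          (maximalIdeal (X'.presheaf.stalk ((normalizationι X').base y)))
          (X'.presheaf.stalk ((normalizationι X').base y))))
      (E : AdicCompletion (maximalIdeal ((normalization X').presheaf.stalk y))
            ((normalization X').presheaf.stalk y) ≃+*
          integralClosure
            (AdicCompletion (maximalIdeal (X'.presheaf.stalk ((normalizationι X').base y)))
              (X'.presheaf.stalk ((normalizationι X').base y)) ⧸ P)
            (FractionRing (AdicCompletion
              (maximalIdeal (X'.presheaf.stalk ((normalizationι X').base y)))
              (X'.presheaf.stalk ((normalizationι X').base y)) ⧸ P))),
      ∀ a : X'.presheaf.stalk ((normalizationι X').base y),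
        E (algebraMap _ _ (((normalizationι X').stalkMap y).hom a)) =
          algebraMap _ _ (Ideal.Quotient.mk P (algebraMap _ _ a)) := by
  classical
  let π : normalization X' ⟶ X' := normalizationι X'
  haveI hfin : IsFinite π := isFinite_normalizationι X' NoetherFiniteIntegralClosure_holds f
  -- the closed point `x = π y` and an affine neighbourhood `U = Spec A`
  have hx : IsClosed ({π y} : Set X') := by
    simpa using π.isClosedMap _ hy
  have hex : ∃ U : X'.Opens, IsAffineOpen U ∧ π y ∈ U := by
    obtain ⟨_, ⟨U, hU, rfl⟩, hxU, -⟩ := X'.isBasis_affineOpens.exists_subset_of_mem_open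
      (Set.mem_univ (π y)) isOpen_univ
    exact ⟨U, hU, hxU⟩
  obtain ⟨U, hU, hxU⟩ := hex
  haveI : Nonempty U := ⟨⟨_, hxU⟩⟩
  have hV : IsAffineOpen (π ⁻¹ᵁ U) := hU.preimage π
  have hyV : y ∈ π ⁻¹ᵁ U := hxU
  -- `A = Γ(X', U)`, a finitely generated `k`-domain with fraction field `K(X')`
  let A := Γ(X', U)
  let φk : k →+* A := (f.appLE ⊤ U le_top).hom.comp (Scheme.ΓSpecIso (.of k)).inv.hom
  have hφk : φk.FiniteType := by
    refine RingHom.FiniteType.comp ?_ (RingHom.FiniteType.of_surjective _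
      (Scheme.ΓSpecIso (.of k)).symm.commRingCatIsoToRingEquiv.surjective)
    exact HasRingHomProperty.appLE @LocallyOfFiniteType f ‹_› ⟨⊤, isAffineOpen_top _⟩ ⟨U, hU⟩
      le_top
  letI : Algebra k A := φk.toAlgebra
  haveI : Algebra.FiniteType k A := hφk
  haveI : IsNoetherianRing A := Algebra.FiniteType.isNoetherianRing k A
  haveI : IsFractionRing A X'.functionField :=
    functionField_isFractionRing_of_isAffineOpen X' U hU
  -- `C₀` = the integral closure of `A` in `K(X')`: finite, birational, normal
  let C₀ : Type := ↥(integralClosure A X'.functionField)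
  haveI : Module.Finite A C₀ := NoetherFiniteIntegralClosure_holds.self k A X'.functionField
  haveI : IsFractionRing C₀ X'.functionField :=
    integralClosure.isFractionRing_of_finite_extension X'.functionField X'.functionField
  haveI : IsIntegrallyClosed C₀ :=
    (isIntegrallyClosed_iff_isIntegrallyClosedIn X'.functionField).mpr inferInstance
  letI : Algebra k C₀ := ((algebraMap A C₀).comp (algebraMap k A)).toAlgebra
  haveI : IsScalarTower k A C₀ := IsScalarTower.of_algebraMap_eq fun _ => rfl
  haveI : Algebra.FiniteType k C₀ :=
    Algebra.FiniteType.trans ‹Algebra.FiniteType k A› inferInstance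
  have hinj : Function.Injective (algebraMap A C₀) := fun a b hab =>
    IsFractionRing.injective A X'.functionField (congrArg Subtype.val hab)
  have hbir : ∀ c : C₀, ∃ s : A, s ≠ 0 ∧ ∃ a : A, s • c = algebraMap A C₀ a := by
    intro c
    obtain ⟨a, s, hs, hc⟩ := IsFractionRing.div_surjective (A := A) c.1
    refine ⟨s, nonZeroDivisors.ne_zero hs, a, Subtype.ext ?_⟩
    have hsK : algebraMap A X'.functionField s ≠ 0 :=
      IsFractionRing.to_map_ne_zero_of_mem_nonZeroDivisors hs
    rw [Subalgebra.coe_smul, ← hc, Algebra.smul_def, mul_div_cancel₀ _ hsK]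
    rfl
  have hdom : ∀ (Q : Ideal C₀) [Q.IsMaximal], IsDomain
      (AdicCompletion (maximalIdeal (Localization.AtPrime Q)) (Localization.AtPrime Q)) := by
    intro Q _
    haveI : IsIntegrallyClosed (Localization.AtPrime Q) :=
      isIntegrallyClosed_of_isLocalization Q.primeCompl Q.primeCompl_le_nonZeroDivisors
        (S := Localization.AtPrime Q)
    exact (isDomain_and_isIntegrallyClosed_adicCompletion_localization_atPrime k Q).1
  -- the maximal ideal `𝔭` of `x = π y` in `A`; the stalk `𝒪_{X',x} = A_𝔭`
  let 𝔭 := hU.primeIdealOf ⟨π y, hxU⟩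
  haveI h𝔭max : 𝔭.asIdeal.IsMaximal := hU.primeIdealOf_isMaximal_of_isClosed ⟨π y, hxU⟩ hx
  letI := X'.presheaf.algebra_section_stalk (⟨π y, hxU⟩ : ↥U)
  haveI := hU.isLocalization_stalk ⟨π y, hxU⟩
  -- `B = Γ(X'^ν, π⁻¹ U) ≅ C₀` compatibly with `A → B`
  letI := ((fromSpecFunctionField X').app U).hom.toAlgebra
  let e := functionFieldAlgEquivSections (X := X') U
  let e₁ : C₀ ≃ₐ[A] integralClosure A Γ(Spec X'.functionField, fromSpecFunctionField X' ⁻¹ᵁ U) :=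
    ((integralClosure A X'.functionField).equivMapOfInjective e.toAlgHom e.injective).trans
      (Subalgebra.equivOfEq _ _ (integralClosure_map_algEquiv e))
  let e₂ := ((fromSpecFunctionField X').normalizationObjIso hU).commRingCatIsoToRingEquiv
  let ε : C₀ ≃+* Γ(normalization X', π ⁻¹ᵁ U) := e₁.toRingEquiv.trans e₂.symm
  have hε : ∀ a : A, ε (algebraMap A C₀ a) = (π.app U).hom a := by
    intro a
    have happ := (fromSpecFunctionField X').fromNormalization_app hU
    change _ = ((fromSpecFunctionField X').fromNormalization.app U).hom a
    rw [happ]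
    change e₂.symm (e₁ (algebraMap A C₀ a)) = e₂.symm (algebraMap A _ a)
    rw [AlgEquiv.commutes]
  -- the stalk `𝒪_{X'^ν,y} = B_𝔔 ≅ (C₀)_Q` for the maximal `Q = ε⁻¹ 𝔔` over `𝔭`
  letI := (normalization X').presheaf.algebra_section_stalk (⟨y, hyV⟩ : ↥(π ⁻¹ᵁ U))
  haveI := hV.isLocalization_stalk ⟨y, hyV⟩
  let 𝔔 := hV.primeIdealOf ⟨y, hyV⟩
  haveI h𝔔max : 𝔔.asIdeal.IsMaximal := hV.primeIdealOf_isMaximal_of_isClosed ⟨y, hyV⟩ hy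
  let Q : Ideal C₀ := 𝔔.asIdeal.comap ε
  haveI : Q.IsMaximal := Ideal.comap_isMaximal_of_surjective ε ε.surjective
  have hQ' : Q = 𝔔.asIdeal.comap (ε : C₀ →+* Γ(normalization X', π ⁻¹ᵁ U)) :=
    Ideal.ext fun _ => Iff.rfl
  have hQ𝔭 : Q.comap (algebraMap A C₀) = 𝔭.asIdeal := by
    have h1 : (ε : C₀ →+* Γ(normalization X', π ⁻¹ᵁ U)).comp (algebraMap A C₀) = (π.app U).hom :=
      RingHom.ext hε
    rw [hQ', Ideal.comap_comap, h1, Scheme.Hom.app_eq_appLE]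
    have h2 := congrArg PrimeSpectrum.asIdeal
      (IsAffineOpen.comap_primeIdealOf_appLE U hU (π ⁻¹ᵁ U) hV le_rfl hyV)
    rwa [PrimeSpectrum.comap_asIdeal] at h2
  -- Zariski: `((C₀)_Q)^` is a normal domain
  haveI : IsIntegrallyClosed (Localization.AtPrime Q) :=
    isIntegrallyClosed_of_isLocalization Q.primeCompl Q.primeCompl_le_nonZeroDivisors
      (S := Localization.AtPrime Q)
  haveI := (isDomain_and_isIntegrallyClosed_adicCompletion_localization_atPrime k Q).2
  -- `eT : 𝒪_{X'^ν,y} ≅ B_𝔔 ≅ (C₀)_Q`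
  let e𝔔 := IsLocalization.algEquiv 𝔔.asIdeal.primeCompl
    ((normalization X').presheaf.stalk ((⟨y, hyV⟩ : ↥(π ⁻¹ᵁ U)) : ↥(normalization X')))
    (Localization.AtPrime 𝔔.asIdeal)
  let eQ𝔔 : Localization.AtPrime Q ≃+* Localization.AtPrime 𝔔.asIdeal :=
    IsLocalization.ringEquivOfRingEquiv (Localization.AtPrime Q) (Localization.AtPrime 𝔔.asIdeal)
      ε (ε.map_primeCompl_comap_eq 𝔔.asIdeal)
  let eT : (normalization X').presheaf.stalk y ≃+* Localization.AtPrime Q :=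
    e𝔔.toRingEquiv.trans eQ𝔔.symm
  have hφ : ∀ a : A, eT ((π.stalkMap y).hom (algebraMap A (X'.presheaf.stalk (π y)) a)) =
      algebraMap C₀ (Localization.AtPrime Q) (algebraMap A C₀ a) := by
    intro a
    have h1 : (π.stalkMap y).hom (algebraMap A (X'.presheaf.stalk (π y)) a) =
        algebraMap Γ(normalization X', π ⁻¹ᵁ U) ((normalization X').presheaf.stalk y)
          ((π.app U).hom a) := by
      simp only [RingHom.algebraMap_toAlgebra]
      exact Scheme.Hom.germ_stalkMap_apply π U y hxU a
    rw [h1, RingEquiv.trans_apply, AlgEquiv.coe_ringEquiv, AlgEquiv.commutes, ← hε,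
      RingEquiv.symm_apply_eq]
    exact (IsLocalization.ringEquivOfRingEquiv_eq _ _).symm
  exact exists_branchEquiv_of_isLocalization hinj hbir hdom 𝔭.asIdeal Q hQ𝔭
    (X'.presheaf.stalk (π y)) ((normalization X').presheaf.stalk y) eT (π.stalkMap y).hom hφ

end Summit.ResolutionOfSingularities.ResolutionOfSingularities.Theorems.TeissierResolve.BranchDictionary

end
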